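import Literature.MathematicalPhysics.QuantumFieldTheory.Balaban1983to89.B7Prop7LinearBound
import Literature.MathematicalPhysics.QuantumFieldTheory.Balaban1983to89.B7Prop7OneStepAnalytic
import Literature.MathematicalPhysics.QuantumFieldTheory.Balaban1983to89.B7Prop6GeneralLevels

/-!
# `Balaban1983to89.B7Prop7Levels` — T. Bałaban, *Averaging operations for lattice gauge theories*, Commun. Math. Phys. **98** (1985)
17–51 [Balaban1985Averaging]: **PROPOSITION 7** (p. 43) — «Q_k(U′U₀, ηA) is analytic in complex variables A′, A, and Proposition 4
holds uniformly in A′» — AT A GENERAL REGULAR BACKGROUND `U₀`, k-UNIFORM, over the concrete `ℤᵈ`/Banach-algebra carrier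

statement-level skeleton of published theorems with citation tags; proofs where landed; nothing here is a claim about the Yang–Mills mass gap

PDF held: `paper:balaban1985-cmp98-averaging` (journal page = PDF page + 16); p. 43 read on the render
`b2b-balaban-ref1/pages/1985-cmp98-averaging/1985-cmp98-averaging-p027-x2.png` (AS AN IMAGE, this unit, 2026-08-21).

CITATION HEADER (lean-in-tree rule).  Cell `lit-balaban`, unit `lit-balaban-r04` (B7 block owner, gen 4; TAKING line HOME/STATUS.md
2026-08-21T04:30:51Z) — SKELETON row **`B7.Prop7`** (typed as the citation statement `B7.Prop7Printed`), the `k`-LEVEL ASSEMBLY of the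
one-step kernels `B7Prop7OneStep` (reduction, log domain, (123) uniformly in the perturbation), `B7Prop7LinearBound` ((126) at the
complex background with leading coefficient `L`) and `B7Prop7OneStepAnalytic` (joint analyticity of the one-step map).

PRINT (p. 43 [PDF 27], verbatim).  «Similarly we repeat the reasoning connected with Proposition 4, but with Ū₀ʲ replaced by
\overline{U′U₀}ʲ = Ũ′ʲŪ₀ʲ. Because of the bound (164), we have to replace the factors e^{O(1)L^{2(j+1)}η²α₀} by
e^{O(1)(L^{2(j+1)}η²α₀ + L^{j+1}ηα₁)}, but this change is easily incorporated into the considerations and the estimates. We get the same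
results as before for α₀, α₁ sufficiently small, uniformly in A′, and additionally, we get the analyticity of Q_k with respect to A′. Let
us formulate these results in  **Proposition 7.** For U₀ satisfying (52) and U′ = e^{iηA′}, |A′| < α₁, α₀, α₁ sufficiently small, the
function Q_k(U′U₀, ηA) is analytic in complex variables A′, A, and Proposition 4 holds uniformly in A′.»

WHAT THIS FILE PROVES (kernel, no `sorry`, standard axioms; theorems only).  DATA (lineage dictionary: `η`, `i` absorbed, `b′` plays
`ηα₁` for `A′`, `b` plays `ηα₁` for `A`, every level on `ℤᵈ`): `L ≥ 2`; `U₀` with values in an averaging-closed subgroup `G ⊂ U1`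
(`B7Prop2Explicit.AvgClosed`), (52) `pdev U₀ < α₀L^{−2k}`, `C₀α₀ ≤ 1/3`, `8α₀ ≤ c₂′(d,L)`; the perturbation `U′ = e^{B′}`, `sup‖B′‖ ≤ b′`
with the Prop.-4/6 smallness `e^{4cα₀}(1 + 8C₁Lᵏb′) ≤ 2`, `2Lᵏb′ ≤ c₃(d,L)` (`c = 800(d+1)²(d+4)`, `C₁ = 131072(d+1)²`) and
`409600(d+1)²·Lᵏb′ ≤ 1` («α₁ sufficiently small»); the field `B`, `sup‖B‖ ≤ b`, with `e^{E}(1 + 8C₁′Lᵏb) ≤ 2` and `2Lᵏb ≤ c₃/4`, where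
`C₁′ = 2097152(d+1)²` and `E = 4480(d+1)²(d+4)α₀ + 240000(d+1)³Lᵏb′` = print's «O(1)(2α₀ + 2α₁)» (the sum of the modified level exponents).
* §1 `linCovIter_succ_mul_background`, `sum_pow_succ_le_two_mul`; the LEVEL DATA at the complex backgrounds `Ũ′ʲ·Ū₀ʲ`:
  `level_background_data` (every `Ū₀ʲ`, `j ≤ k`, is `U1`-valued with block loops within `32(d+1)(d+4)L²α₀(Lʲ/Lᵏ)² ≤ 1/128` of `1` — Props. 1–2)
  and `level_pert_data` (**(164) at every level**: `‖Ũ′ʲ − 1‖, ‖(Ũ′ʲ)⁻¹ − 1‖ ≤ 400(d+1)Lʲb′` — `B7Prop6GeneralLevels.eq164_general_unconditional`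
  with `k := j`; print's census item (e) «NO complex version of Props. 1–2 is needed: the background averages … are controlled by (164) at level j»).
* §2 **`prop7_prop4_uniform`** — «PROPOSITION 4 HOLDS UNIFORMLY IN A′»: for every `j ≤ k` and every `Lʲ`-bond, (130) `‖Q_j(U′U₀, ηB) −
  LʲηQ_j(U′U₀)B‖ ≤ 8C₁′e^{E}(Lʲb)²` and (131) `‖Q_j(U′U₀, ηB)‖ ≤ 2Lʲb` for the composites `logCovIter / linCovIter L (e^{B′}U₀) B`, the constants
  depending on `d` (and on the displayed small parameters) but NOT on `U′`, `k`, `j` — `B7Prop4GeneralInduction.prop4_induction` with the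
  one-step inputs at the complex level backgrounds: `hrem` = `B7Prop7OneStep.norm_Ccov_cplx_le_explicit`, `hlin` = `B7Prop7LinearBound.norm_linQcov_cplx_le`
  (`κ_j = 70(d+1)α_j + 150(d+1)(2d+2)L·u_j`, `∏(1+κ_j) ≤ e^{E}` by the two geometric sums), `hΛsub` = `B7Eq123General.linQcov_sub_of_loops`;
  the binders are the standalone theorems `level_sub` / `level_rem` / `level_lin` (with `level_nu_le`, `level_loops_lt_one`, `levelFactors_cplx_le_exp`).
* §3 **`prop7_analyticAt`** — «Q_k(U′U₀, ηA) IS ANALYTIC IN COMPLEX VARIABLES A′, A»: for bondwise-analytic families `B′(t)`, `B(t)` (`t` in any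
  complex normed space `E`, e.g. `(a′, a) ∈ 𝔸^S × 𝔸^S` with bond insertions) satisfying the data above at `t₀`, every composite
  `t ↦ Q_j(e^{B′(t)}U₀, B(t))(c)`, `j ≤ k`, is analytic at `t₀`; with it `analyticAt_avgIter_cplx` (the level backgrounds `\overline{U′U₀}ʲ(t)` are
  bondwise-analytic unit families — Prop. 6's analyticity clause re-derived along the way).
HONEST DIVERGENCES (located): strict `<` ↦ `≤`; thresholds displayed separately and `d`-dependent explicit constants as admissible witnesses
of print's «sufficiently small»/`O(1)` (`c₃/4` for `c₃`, `C₁′ = 16C₁`); (136) and the Prop. 5 extension («Similarly, Proposition 5 may be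
extended … The formulations are obvious») are not typed here; global sup bounds on `ℤᵈ`.
REUSED BY NAME: `B7Prop4GeneralInduction.prop4_induction / prod_one_add_le_exp_sum`, `B7Prop4GeneralLevels.logCovIter / linCovIter / level_regularity /
sum_level_weights_le_two`, `B7Eq123General.level_data / blockLoops_of_pdev / linQcov_sub_of_loops`, `B7Prop6GeneralLevels.eq164_general_unconditional`,
`B7AvgGaugeCovariance.hyp52_mono`, `B7Eq92Concrete.tildIter / tildIter_apply / tildIter_mul / avgIter`, `B7Prop7OneStep.*`, `B7Prop7LinearBound.*`,
`B7Prop7OneStepAnalytic.*`.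
Unit `lit-balaban-r04` (gen 4), 2026-08-21.

[cite: Balaban1985Averaging, Proposition 7 p.43]
-/

noncomputable section

open scoped BigOperators
open NormedSpace Metric Set Finset

namespace Literature.MathematicalPhysics.QuantumFieldTheory.Balaban1983to89.B7Prop7Levels

open B7Prop1Explicit B7Prop2Explicit B7Prop3Flat B7Eq92Concrete MatrixLog B7Prop3GeneralAnalytic B7Prop3GeneralLinear
  B7Prop4GeneralInduction B7Prop4GeneralLevels B7Eq123General B7Prop6GeneralLevels B7Prop7OneStep B7Prop7LinearBound
  B7Prop7OneStepAnalytic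
open B7AvgGaugeCovariance (hyp52_mono)

-- `Site` alone would resolve to the torus sites of `Setup.lean`; re-export the `ℤ^d` sites of `B7Prop1Explicit`.
export B7Prop1Explicit (Site)

variable {d : ℕ}

variable {𝔸 : Type*} [NormedRing 𝔸] [NormedAlgebra ℂ 𝔸] [CompleteSpace 𝔸] [NormOneClass 𝔸]
variable {E : Type*} [NormedAddCommGroup E] [NormedSpace ℂ E]

/-! ## §1 Bookkeeping and the level data at the complex backgrounds `Ũ′ʲ·Ū₀ʲ` -/

omit [NormOneClass 𝔸] in
/-- the composed LINEAR parts of `Q_k(U′U₀, ·)`: the `(j+1)`-st factor is the one-step linear part (122) at the complex level background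
`Ũ′ʲ·Ū₀ʲ` (companion of `B7Prop7OneStep.logCovIter_succ_mul_background`). [cite: Balaban1985Averaging, Proposition 7 p.43, p.38 (before (133))] -/
theorem linCovIter_succ_mul_background (L : ℕ) (U₀ U' : Site d → Fin d → 𝔸ˣ) (B : Site d → Fin d → 𝔸) (j : ℕ) (z : Site d)
    (κ : Fin d) :
    linCovIter L (U' * U₀) B (j + 1) z κ
      = linQcov L (tildIter L U₀ U' j * avgIter L U₀ j) (linCovIter L (U' * U₀) B j) ((L : ℤ) • z) κ := by
  rw [linCovIter_succ, tildIter_mul]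

/-- the geometric sum of the new level exponents «L^{j+1}ηα₁»: `Σ_{j<k} L^{j+1} ≤ 2Lᵏ` for `L ≥ 2` (so `Σ_j L^{j+1}ηα₁ ≤ 2α₁`, as in
«e^{O(1)(… + L^{j+1}ηα₁)}» summed over the levels). [cite: Balaban1985Averaging, Proposition 7 p.43, (133) p.38] -/
theorem sum_pow_succ_le_two_mul {L : ℝ} (hL : 2 ≤ L) : ∀ k : ℕ, ∑ j ∈ range k, L ^ (j + 1) ≤ 2 * L ^ k
  | 0 => by simp
  | k + 1 => by
    rw [sum_range_succ, pow_succ]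
    have ih := sum_pow_succ_le_two_mul hL k
    have hLk : 0 ≤ L ^ k := pow_nonneg (by linarith) k
    nlinarith

/-- partial products of factors `≥ 1` are monotone. [folklore] -/
private theorem prod_range_mono (κ : ℕ → ℝ) (hκ : ∀ i, 0 ≤ κ i) {m n : ℕ} (h : m ≤ n) :
    ∏ i ∈ range m, (1 + κ i) ≤ ∏ i ∈ range n, (1 + κ i) := by
  induction n, h using Nat.le_induction with
  | base => exact le_rfl
  | succ n _ ih =>
    rw [prod_range_succ]
    have h1 : 0 ≤ ∏ i ∈ range n, (1 + κ i) := prod_nonneg fun i _ => by linarith [hκ i]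
    have h2 : 1 ≤ 1 + κ n := by linarith [hκ n]
    nlinarith

/-- **THE UNITARY PART OF THE LEVEL BACKGROUNDS**: under (52) with `8α₀ ≤ c₂′(d,L)`, every `Ū₀ʲ`, `j ≤ k`, is `U1`-valued and its block loops
at every `L`-bond are within `32(d+1)(d+4)L²·α₀(Lʲ/Lᵏ)² ≤ 1/128` of `1` (Prop. 2 per level = `B7Eq123General.level_data`, Prop. 1 =
`blockLoops_of_pdev`) — print's «factors e^{O(1)L^{2(j+1)}η²α₀}». [cite: Balaban1985Averaging, Proposition 7 p.43, p.37 (after (127)), Prop. 2 (54) p.26] -/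
theorem level_background_data (L : ℕ) (hL : 2 ≤ L) {G : Subgroup 𝔸ˣ} (hG : AvgClosed d L G) (k : ℕ)
    (U₀ : Site d → Fin d → 𝔸ˣ) (hU₀ : ∀ x κ, U₀ x κ ∈ G) {α₀ : ℝ} (hα : 0 < α₀)
    (hα3 : C0 d * α₀ ≤ 1 / 3) (hα8 : 8 * α₀ ≤ c2' d L) (h52 : pdev U₀ < α₀ * (((L : ℝ) ^ k)⁻¹) ^ 2) :
    ∀ j ≤ k, (∀ x κ, avgIter L U₀ j x κ ∈ U1 𝔸) ∧
      ∀ (q : Site d) (κ : Fin d),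
        (∀ r : Fin d → Fin L, ‖((Wcx L (avgIter L U₀ j) q κ (boxVec L r) : 𝔸ˣ) : 𝔸) - 1‖
          ≤ 32 * ((d : ℝ) + 1) * ((d : ℝ) + 4) * (L : ℝ) ^ 2 * (α₀ * ((L : ℝ) ^ j * ((L : ℝ) ^ k)⁻¹) ^ 2)) ∧
        32 * ((d : ℝ) + 1) * ((d : ℝ) + 4) * (L : ℝ) ^ 2 * (α₀ * ((L : ℝ) ^ j * ((L : ℝ) ^ k)⁻¹) ^ 2) ≤ 1 / 128 := by
  intro j hj
  have hL1 : 1 ≤ L := le_trans (by norm_num) hL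
  have hα4 : 4 * α₀ ≤ c2' d L := by linarith
  obtain ⟨hV, hβ0, hβ, hβmax⟩ := level_data L hL hG k U₀ hU₀ hα hα3 hα4 h52 j hj
  refine ⟨hV, fun q κ => ?_⟩
  obtain ⟨hreg, -⟩ := blockLoops_of_pdev hL1 hV hβ0 hβ hβmax q κ
  refine ⟨fun r => (hreg r).trans (le_of_eq (by ring)), ?_⟩
  -- `32(d+1)(d+4)L²α₀·s² ≤ 32(d+1)(d+4)L²·c₂′/8 = 1/128`
  have hL1r : (1 : ℝ) ≤ L := by exact_mod_cast hL1
  have hLk : (0 : ℝ) < (L : ℝ) ^ k := by positivity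
  have hratio : (L : ℝ) ^ j * ((L : ℝ) ^ k)⁻¹ ≤ 1 := by
    rw [mul_inv_le_iff₀ hLk, one_mul]; exact pow_le_pow_right₀ hL1r hj
  have hs1 : ((L : ℝ) ^ j * ((L : ℝ) ^ k)⁻¹) ^ 2 ≤ 1 := by
    rw [← one_pow 2]; exact pow_le_pow_left₀ (by positivity) hratio 2
  have hX : (0 : ℝ) < 512 * ((d : ℝ) + 1) * ((d : ℝ) + 4) * (L : ℝ) ^ 2 := by positivity
  have hc : 512 * ((d : ℝ) + 1) * ((d : ℝ) + 4) * (L : ℝ) ^ 2 * c2' d L = 1 := by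
    rw [c2', one_div, mul_inv_cancel₀ hX.ne']
  have h1 : 512 * ((d : ℝ) + 1) * ((d : ℝ) + 4) * (L : ℝ) ^ 2 * (8 * α₀) ≤ 1 :=
    (mul_le_mul_of_nonneg_left hα8 hX.le).trans hc.le
  have hY : 0 ≤ ((d : ℝ) + 1) * ((d : ℝ) + 4) * (L : ℝ) ^ 2 * α₀ := by positivity
  nlinarith [mul_le_mul_of_nonneg_left hs1 hY]

/-- **(164) AT EVERY LEVEL — «Because of the bound (164) …» / census item (e)**: under (52), `C₀α₀ ≤ 1/3`, `4α₀ ≤ c₂′`, the Prop.-4/6 smallness for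
`U′ = e^{B′}` (`sup‖B′‖ ≤ b′`) and `409600(d+1)²Lᵏb′ ≤ 1`, the perturbations `Ũ′ʲ = \overline{U′U₀}ʲ(Ū₀ʲ)⁻¹` (69) satisfy
`‖Ũ′ʲ(b) − 1‖ ≤ 200(d+1)Lʲb′ ≤ 400(d+1)Lʲb′` and `‖Ũ′ʲ(b)⁻¹ − 1‖ ≤ 400(d+1)Lʲb′` for every `j ≤ k` (`B7Prop6GeneralLevels.eq164_general_unconditional` at `k := j`).
[cite: Balaban1985Averaging, Proposition 7 p.43, Proposition 6 (164) p.43] -/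
theorem level_pert_data (L : ℕ) (hL : 2 ≤ L) {G : Subgroup 𝔸ˣ} (hG : AvgClosed d L G) (k : ℕ)
    (U₀ : Site d → Fin d → 𝔸ˣ) (hU₀ : ∀ x κ, U₀ x κ ∈ G) {α₀ : ℝ} (hα : 0 < α₀)
    (hα3 : C0 d * α₀ ≤ 1 / 3) (hα4 : 4 * α₀ ≤ c2' d L) (h52 : pdev U₀ < α₀ * (((L : ℝ) ^ k)⁻¹) ^ 2)
    (B' : Site d → Fin d → 𝔸) {b' : ℝ} (hb' : 0 ≤ b') (hB' : ∀ x κ, ‖B' x κ‖ ≤ b')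
    (hsmall' : Real.exp (4 * (800 * ((d : ℝ) + 1) ^ 2 * ((d : ℝ) + 4)) * α₀)
      * (1 + 8 * (131072 * ((d : ℝ) + 1) ^ 2) * ((L : ℝ) ^ k * b')) ≤ 2)
    (hc₃' : 2 * ((L : ℝ) ^ k * b') ≤ c3 d L) (hb'1 : 409600 * ((d : ℝ) + 1) ^ 2 * ((L : ℝ) ^ k * b') ≤ 1) :
    ∀ j ≤ k, ∀ (z : Site d) (κ : Fin d),
      ‖((tildIter L U₀ (expCfg B') j z κ : 𝔸ˣ) : 𝔸) - 1‖ ≤ 400 * ((d : ℝ) + 1) * ((L : ℝ) ^ j * b') ∧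
      ‖(((tildIter L U₀ (expCfg B') j z κ)⁻¹ : 𝔸ˣ) : 𝔸) - 1‖ ≤ 400 * ((d : ℝ) + 1) * ((L : ℝ) ^ j * b') := by
  intro j hj z κ
  have hL1 : 1 ≤ L := le_trans (by norm_num) hL
  have hL1r : (1 : ℝ) ≤ L := by exact_mod_cast hL1
  have hjk : (L : ℝ) ^ j * b' ≤ (L : ℝ) ^ k * b' := mul_le_mul_of_nonneg_right (pow_le_pow_right₀ hL1r hj) hb'
  -- the hypotheses of `eq164_general_unconditional` at level `j`
  have h52j := hyp52_mono (V := U₀) hL1 hα.le hj h52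
  have hsmallj : Real.exp (4 * (800 * ((d : ℝ) + 1) ^ 2 * ((d : ℝ) + 4)) * α₀)
      * (1 + 8 * (131072 * ((d : ℝ) + 1) ^ 2) * ((L : ℝ) ^ j * b')) ≤ 2 := by
    refine le_trans (mul_le_mul_of_nonneg_left ?_ (Real.exp_pos _).le) hsmall'
    nlinarith
  have hc₃j : 2 * ((L : ℝ) ^ j * b') ≤ c3 d L := by linarith
  have h164 := eq164_general_unconditional L hL hG j U₀ hU₀ hα hα3 hα4 h52j B' hb' hB' hsmallj hc₃j z κ
  have h1 : ‖((tildIter L U₀ (expCfg B') j z κ : 𝔸ˣ) : 𝔸) - 1‖ ≤ 200 * ((d : ℝ) + 1) * ((L : ℝ) ^ j * b') := by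
    rw [tildIter_apply, Units.val_mul]; exact h164
  have hpos : 0 ≤ 200 * ((d : ℝ) + 1) * ((L : ℝ) ^ j * b') := by positivity
  refine ⟨h1.trans (by linarith), ?_⟩
  have hhalf : 200 * ((d : ℝ) + 1) * ((L : ℝ) ^ j * b') ≤ 1 / 2 := by
    have hd : (1 : ℝ) ≤ (d : ℝ) + 1 := by linarith [Nat.cast_nonneg (α := ℝ) d]
    nlinarith [mul_nonneg (by positivity : (0 : ℝ) ≤ (d : ℝ) + 1) (mul_nonneg (pow_nonneg (by positivity) j) hb')]
  exact (norm_units_inv_sub_one_le_two_mul _ h1 hhalf).trans (le_of_eq (by ring))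

/-! ## §2 «Proposition 4 holds uniformly in A′»: (130)/(131) for `Q_j(U′U₀, ·)` at every level, k-uniform, `U′`-uniform -/

section Levels

variable (L : ℕ) (hL : 2 ≤ L) {G : Subgroup 𝔸ˣ} (hG : AvgClosed d L G) (k : ℕ)
  (U₀ : Site d → Fin d → 𝔸ˣ) (hU₀ : ∀ x κ, U₀ x κ ∈ G) {α₀ : ℝ} (hα : 0 < α₀)
  (hα3 : C0 d * α₀ ≤ 1 / 3) (hα8 : 8 * α₀ ≤ c2' d L) (h52 : pdev U₀ < α₀ * (((L : ℝ) ^ k)⁻¹) ^ 2)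
  (B' : Site d → Fin d → 𝔸) {b' : ℝ} (hb' : 0 ≤ b') (hB' : ∀ x κ, ‖B' x κ‖ ≤ b')
  (hsmall' : Real.exp (4 * (800 * ((d : ℝ) + 1) ^ 2 * ((d : ℝ) + 4)) * α₀)
    * (1 + 8 * (131072 * ((d : ℝ) + 1) ^ 2) * ((L : ℝ) ^ k * b')) ≤ 2)
  (hc₃' : 2 * ((L : ℝ) ^ k * b') ≤ c3 d L) (hb'1 : 409600 * ((d : ℝ) + 1) ^ 2 * ((L : ℝ) ^ k * b') ≤ 1)

include hL hb' hb'1 in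
/-- «L^{j+1}ηα₁» small at every level `j < k`: `(2d+2)L·400(d+1)Lʲb′ = 800(d+1)²L^{j+1}b′ ≤ 1/512`. [cite: Balaban1985Averaging, Proposition 7 p.43] -/
theorem level_nu_le {j : ℕ} (hj : j < k) :
    ((2 * (d * L) + L + L : ℕ) : ℝ) * (400 * ((d : ℝ) + 1) * ((L : ℝ) ^ j * b')) ≤ 1 / 512 := by
  have hL1r : (1 : ℝ) ≤ L := by exact_mod_cast le_trans (by norm_num) hL
  have hncast : (((2 * (d * L) + L + L : ℕ)) : ℝ) = 2 * ((d : ℝ) + 1) * L := by push_cast; ring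
  have hjk : (L : ℝ) ^ (j + 1) * b' ≤ (L : ℝ) ^ k * b' :=
    mul_le_mul_of_nonneg_right (pow_le_pow_right₀ hL1r (by omega)) hb'
  rw [hncast]
  have e : 2 * ((d : ℝ) + 1) * L * (400 * ((d : ℝ) + 1) * ((L : ℝ) ^ j * b'))
      = 800 * ((d : ℝ) + 1) ^ 2 * ((L : ℝ) ^ (j + 1) * b') := by rw [pow_succ]; ring
  rw [e]
  nlinarith [sq_nonneg ((d : ℝ) + 1)]

include hL hG hU₀ hα hα3 hα8 h52 hb' hB' hsmall' hc₃' hb'1 in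
/-- **the block loops of the complex level background `Ũ′ʲ·Ū₀ʲ` are in the domain of the series logarithm** (within `1/32`), `j < k`
(`B7Prop7OneStep.logDomainCplx_lt` with the zero field). [cite: Balaban1985Averaging, Proposition 7 p.43, (120) p.35] -/
theorem level_loops_lt_one {j : ℕ} (hj : j < k) (q : Site d) (κ : Fin d) (r : Fin d → Fin L) :
    ‖((Wcx L (tildIter L U₀ (expCfg B') j * avgIter L U₀ j) q κ (boxVec L r) : 𝔸ˣ) : 𝔸) - 1‖ < 1 := by
  have hL1 : 1 ≤ L := le_trans (by norm_num) hL
  have hα4 : 4 * α₀ ≤ c2' d L := by linarith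
  obtain ⟨hV, hloops⟩ := level_background_data L hL hG k U₀ hU₀ hα hα3 hα8 h52 j hj.le
  obtain ⟨hreg, hα1⟩ := hloops q κ
  have hU := level_pert_data L hL hG k U₀ hU₀ hα hα3 hα4 h52 B' hb' hB' hsmall' hc₃' hb'1 j hj.le
  have hnu := level_nu_le L hL k hb' hb'1 hj
  exact (logDomainCplx_lt hL1 hV (by positivity) hU (0 : Site d → Fin d → 𝔸) (a := 0) le_rfl (fun x μ => by simp)
    (θ := 1 / 128) (by nlinarith) (by norm_num) le_rfl q κ hα1 hreg).1 r

include hL hG hU₀ hα hα3 hα8 h52 hb' hB' hsmall' hc₃' hb'1 in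
/-- the binder `hΛsub` of the induction: additivity of the linear part at every complex level background (`B7Eq123General.linQcov_sub_of_loops`).
[cite: Balaban1985Averaging, Proposition 7 p.43, (122) p.36] -/
theorem level_sub {j : ℕ} (hj : j < k) (A A' : Site d → Fin d → 𝔸) (z : Site d) (κ : Fin d) :
    linQcov L (tildIter L U₀ (expCfg B') j * avgIter L U₀ j) (A - A') ((L : ℤ) • z) κ
      = linQcov L (tildIter L U₀ (expCfg B') j * avgIter L U₀ j) A ((L : ℤ) • z) κ
        - linQcov L (tildIter L U₀ (expCfg B') j * avgIter L U₀ j) A' ((L : ℤ) • z) κ :=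
  linQcov_sub_of_loops L _ A A' _ κ (level_loops_lt_one L hL hG k U₀ hU₀ hα hα3 hα8 h52 B' hb' hB' hsmall' hc₃' hb'1 hj _ κ)

include hL hG hU₀ hα hα3 hα8 h52 hb' hB' hsmall' hc₃' hb'1 in
/-- the binder `hrem` of the induction: (123) at every complex level background, `C₁′ = 2097152(d+1)²`, fields up to `c₃/4`
(`B7Prop7OneStep.norm_Ccov_cplx_le_explicit`). [cite: Balaban1985Averaging, Proposition 7 p.43, Proposition 3 (123) p.36] -/
theorem level_rem {j : ℕ} (hj : j < k) (A : Site d → Fin d → 𝔸) (r : ℝ) (hr : 0 ≤ r) (hrc : r ≤ c3 d L / 4)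
    (hA : ∀ x y, ‖A x y‖ ≤ r) (z : Site d) (κ : Fin d) :
    ‖Qcov L (tildIter L U₀ (expCfg B') j * avgIter L U₀ j) A ((L : ℤ) • z) κ
        - linQcov L (tildIter L U₀ (expCfg B') j * avgIter L U₀ j) A ((L : ℤ) • z) κ‖
      ≤ 2097152 * ((d : ℝ) + 1) ^ 2 * (L : ℝ) ^ 2 * r ^ 2 := by
  have hL1 : 1 ≤ L := le_trans (by norm_num) hL
  have hα4 : 4 * α₀ ≤ c2' d L := by linarith
  obtain ⟨hV, hloops⟩ := level_background_data L hL hG k U₀ hU₀ hα hα3 hα8 h52 j hj.le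
  obtain ⟨hreg, hα1⟩ := hloops ((L : ℤ) • z) κ
  have hU := level_pert_data L hL hG k U₀ hU₀ hα hα3 hα4 h52 B' hb' hB' hsmall' hc₃' hb'1 j hj.le
  have hnu := level_nu_le L hL k hb' hb'1 hj
  have h := norm_Ccov_cplx_le_explicit hL1 hV (by positivity) hU hnu A hr hA hrc ((L : ℤ) • z) κ hα1 hreg
  rwa [Ccov] at h

include hL hG hU₀ hα hα3 hα8 h52 hb' hB' hsmall' hc₃' hb'1 in
/-- the binder `hlin` of the induction: the modified (126) at every complex level background, `‖L(Q(Ũ′ʲŪ₀ʲ)A)_c‖ ≤ L(1 + κ_j)r` with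
`κ_j = 70(d+1)·[32(d+1)(d+4)L²α₀(Lʲ/Lᵏ)²] + 150(d+1)·(2d+2)L·400(d+1)Lʲb′` — print's «e^{O(1)(L^{2(j+1)}η²α₀ + L^{j+1}ηα₁)}»
(`B7Prop7LinearBound.norm_linQcov_cplx_le`). [cite: Balaban1985Averaging, Proposition 7 p.43, (126) p.36] -/
theorem level_lin {j : ℕ} (hj : j < k) (A : Site d → Fin d → 𝔸) (r : ℝ) (hr : 0 ≤ r) (hA : ∀ x y, ‖A x y‖ ≤ r)
    (z : Site d) (κ : Fin d) :
    ‖linQcov L (tildIter L U₀ (expCfg B') j * avgIter L U₀ j) A ((L : ℤ) • z) κ‖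
      ≤ L * (1 + (70 * (d + 1) * (32 * ((d : ℝ) + 1) * ((d : ℝ) + 4) * (L : ℝ) ^ 2 * (α₀ * ((L : ℝ) ^ j * ((L : ℝ) ^ k)⁻¹) ^ 2))
        + 150 * (d + 1) * (((2 * (d * L) + L + L : ℕ) : ℝ) * (400 * ((d : ℝ) + 1) * ((L : ℝ) ^ j * b'))))) * r := by
  have hL1 : 1 ≤ L := le_trans (by norm_num) hL
  have hα4 : 4 * α₀ ≤ c2' d L := by linarith
  obtain ⟨hV, hloops⟩ := level_background_data L hL hG k U₀ hU₀ hα hα3 hα8 h52 j hj.le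
  obtain ⟨hreg, hα1⟩ := hloops ((L : ℤ) • z) κ
  have hU := level_pert_data L hL hG k U₀ hU₀ hα hα3 hα4 h52 B' hb' hB' hsmall' hc₃' hb'1 j hj.le
  have hnu := level_nu_le L hL k hb' hb'1 hj
  have h := norm_linQcov_cplx_le L hL1 hV (by positivity) hU hnu hr hA ((L : ℤ) • z) κ (hα1.trans (by norm_num)) hreg
  refine h.trans (le_of_eq ?_)
  ring

include hL hα hb' in
/-- **the product of the modified level factors is k-uniform**: `∏_{j<k}(1 + κ_j) ≤ e^{E}`, `E = 4480(d+1)²(d+4)α₀ + 240000(d+1)³Lᵏb′` — the two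
geometric sums `Σ L²(Lʲ/Lᵏ)² ≤ 2` and `Σ L^{j+1} ≤ 2Lᵏ` (print's «uniformly in A′ … the same results as before»).
[cite: Balaban1985Averaging, Proposition 7 p.43, (133) p.38] -/
theorem levelFactors_cplx_le_exp :
    ∏ j ∈ range k, (1 + (70 * (d + 1) * (32 * ((d : ℝ) + 1) * ((d : ℝ) + 4) * (L : ℝ) ^ 2 * (α₀ * ((L : ℝ) ^ j * ((L : ℝ) ^ k)⁻¹) ^ 2))
        + 150 * (d + 1) * (((2 * (d * L) + L + L : ℕ) : ℝ) * (400 * ((d : ℝ) + 1) * ((L : ℝ) ^ j * b')))))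
      ≤ Real.exp (4480 * ((d : ℝ) + 1) ^ 2 * ((d : ℝ) + 4) * α₀ + 240000 * ((d : ℝ) + 1) ^ 3 * ((L : ℝ) ^ k * b')) := by
  have hLr : (2 : ℝ) ≤ L := by exact_mod_cast hL
  have hncast : (((2 * (d * L) + L + L : ℕ)) : ℝ) = 2 * ((d : ℝ) + 1) * L := by push_cast; ring
  have hκ0 : ∀ j, 0 ≤ 70 * (d + 1) * (32 * ((d : ℝ) + 1) * ((d : ℝ) + 4) * (L : ℝ) ^ 2 * (α₀ * ((L : ℝ) ^ j * ((L : ℝ) ^ k)⁻¹) ^ 2))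
      + 150 * (d + 1) * (((2 * (d * L) + L + L : ℕ) : ℝ) * (400 * ((d : ℝ) + 1) * ((L : ℝ) ^ j * b'))) :=
    fun j => by positivity
  refine (prod_one_add_le_exp_sum _ hκ0 k).trans (Real.exp_le_exp.2 ?_)
  have h1 : ∀ j, 70 * (d + 1) * (32 * ((d : ℝ) + 1) * ((d : ℝ) + 4) * (L : ℝ) ^ 2 * (α₀ * ((L : ℝ) ^ j * ((L : ℝ) ^ k)⁻¹) ^ 2))
      = (2240 * ((d : ℝ) + 1) ^ 2 * ((d : ℝ) + 4) * α₀) * ((L : ℝ) ^ 2 * ((L : ℝ) ^ j * ((L : ℝ) ^ k)⁻¹) ^ 2) :=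
    fun j => by ring
  have h2 : ∀ j, 150 * (d + 1) * (((2 * (d * L) + L + L : ℕ) : ℝ) * (400 * ((d : ℝ) + 1) * ((L : ℝ) ^ j * b')))
      = (120000 * ((d : ℝ) + 1) ^ 3 * b') * (L : ℝ) ^ (j + 1) := fun j => by rw [hncast, pow_succ]; ring
  simp_rw [h1, h2]
  have e1 : ∑ j ∈ range k, (2240 * ((d : ℝ) + 1) ^ 2 * ((d : ℝ) + 4) * α₀) * ((L : ℝ) ^ 2 * ((L : ℝ) ^ j * ((L : ℝ) ^ k)⁻¹) ^ 2)
      = (2240 * ((d : ℝ) + 1) ^ 2 * ((d : ℝ) + 4) * α₀) * ∑ j ∈ range k, (L : ℝ) ^ 2 * ((L : ℝ) ^ j * ((L : ℝ) ^ k)⁻¹) ^ 2 := by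
    rw [Finset.mul_sum]
  have e2 : ∑ j ∈ range k, (120000 * ((d : ℝ) + 1) ^ 3 * b') * (L : ℝ) ^ (j + 1)
      = (120000 * ((d : ℝ) + 1) ^ 3 * b') * ∑ j ∈ range k, (L : ℝ) ^ (j + 1) := by
    rw [Finset.mul_sum]
  rw [Finset.sum_add_distrib, e1, e2]
  have hs1 := sum_level_weights_le_two hLr k
  have hs2 := sum_pow_succ_le_two_mul hLr k
  have hA0 : 0 ≤ 2240 * ((d : ℝ) + 1) ^ 2 * ((d : ℝ) + 4) * α₀ := by positivity
  have hB0 : 0 ≤ 120000 * ((d : ℝ) + 1) ^ 3 * b' := by positivity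
  have i1 := mul_le_mul_of_nonneg_left hs1 hA0
  have i2 := mul_le_mul_of_nonneg_left hs2 hB0
  have e3 : (120000 * ((d : ℝ) + 1) ^ 3 * b') * (2 * (L : ℝ) ^ k) = 240000 * ((d : ℝ) + 1) ^ 3 * ((L : ℝ) ^ k * b') := by ring
  have e4 : (2240 * ((d : ℝ) + 1) ^ 2 * ((d : ℝ) + 4) * α₀) * 2 = 4480 * ((d : ℝ) + 1) ^ 2 * ((d : ℝ) + 4) * α₀ := by ring
  linarith

include hL hG hU₀ hα hα3 hα8 h52 hb' hB' hsmall' hc₃' hb'1 in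
/-- **PROPOSITION 7, THE BOUNDS — «we repeat the reasoning connected with Proposition 4, but with Ū₀ʲ replaced by \overline{U′U₀}ʲ = Ũ′ʲŪ₀ʲ …
We get the same results as before for α₀, α₁ sufficiently small, uniformly in A′»**: under the DATA of the module docstring, for every
`j ≤ k` and every `Lʲ`-bond `c`: (130) `‖Q_j(U′U₀, ηB)(c) − LʲηQ_j(U′U₀)B(c)‖ ≤ 8C₁′e^{E}(Lʲb)²` and (131) `‖Q_j(U′U₀, ηB)(c)‖ ≤ 2Lʲb`, the
composites being `logCovIter / linCovIter L (e^{B′}U₀) B j`; `C₁′ = 2097152(d+1)²`, `E = 4480(d+1)²(d+4)α₀ + 240000(d+1)³Lᵏb′` — independent of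
`U′`, `j`, `k`.  Proof: `B7Prop4GeneralInduction.prop4_induction` with the one-step binders `level_sub` / `level_rem` / `level_lin` at the complex level
backgrounds and `levelFactors_cplx_le_exp`. [cite: Balaban1985Averaging, Proposition 7 p.43, Proposition 4 (130)–(131) p.38] -/
theorem prop7_prop4_uniform (B : Site d → Fin d → 𝔸) {b : ℝ} (hb : 0 ≤ b) (hB : ∀ x κ, ‖B x κ‖ ≤ b)
    (hsmall : Real.exp (4480 * ((d : ℝ) + 1) ^ 2 * ((d : ℝ) + 4) * α₀ + 240000 * ((d : ℝ) + 1) ^ 3 * ((L : ℝ) ^ k * b'))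
      * (1 + 8 * (2097152 * ((d : ℝ) + 1) ^ 2) * ((L : ℝ) ^ k * b)) ≤ 2)
    (hc₃ : 2 * ((L : ℝ) ^ k * b) ≤ c3 d L / 4) :
    ∀ j ≤ k,
      (∀ z κ, ‖logCovIter L (expCfg B' * U₀) B j z κ - linCovIter L (expCfg B' * U₀) B j z κ‖
        ≤ 8 * (2097152 * ((d : ℝ) + 1) ^ 2)
          * Real.exp (4480 * ((d : ℝ) + 1) ^ 2 * ((d : ℝ) + 4) * α₀ + 240000 * ((d : ℝ) + 1) ^ 3 * ((L : ℝ) ^ k * b'))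
          * ((L : ℝ) ^ j * b) ^ 2) ∧
      (∀ z κ, ‖logCovIter L (expCfg B' * U₀) B j z κ‖ ≤ 2 * ((L : ℝ) ^ j * b)) := by
  have hL1 : 1 ≤ L := le_trans (by norm_num) hL
  have hLr : (2 : ℝ) ≤ L := by exact_mod_cast hL
  have hκ0 : ∀ j, 0 ≤ 70 * (d + 1) * (32 * ((d : ℝ) + 1) * ((d : ℝ) + 4) * (L : ℝ) ^ 2 * (α₀ * ((L : ℝ) ^ j * ((L : ℝ) ^ k)⁻¹) ^ 2))
      + 150 * (d + 1) * (((2 * (d * L) + L + L : ℕ) : ℝ) * (400 * ((d : ℝ) + 1) * ((L : ℝ) ^ j * b'))) :=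
    fun j => by positivity
  have hP := levelFactors_cplx_le_exp (d := d) L hL k hα hb'
  have hmain := prop4_induction (σ := Site d) (τ := Fin d) (𝔸 := 𝔸) (c₃ := c3 d L / 4)
    (P := Real.exp (4480 * ((d : ℝ) + 1) ^ 2 * ((d : ℝ) + 4) * α₀ + 240000 * ((d : ℝ) + 1) ^ 3 * ((L : ℝ) ^ k * b')))
    hLr (C₁ := 2097152 * ((d : ℝ) + 1) ^ 2) (by positivity) (k := k) _ hκ0
    (fun j A z κ' => Qcov L (tildIter L U₀ (expCfg B') j * avgIter L U₀ j) A ((L : ℤ) • z) κ')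
    (fun j A z κ' => linQcov L (tildIter L U₀ (expCfg B') j * avgIter L U₀ j) A ((L : ℤ) • z) κ')
    (fun j hj A A' => funext fun z => funext fun κ' =>
      level_sub L hL hG k U₀ hU₀ hα hα3 hα8 h52 B' hb' hB' hsmall' hc₃' hb'1 hj A A' z κ')
    (fun j hj A r hr hrc hA z κ' => level_rem L hL hG k U₀ hU₀ hα hα3 hα8 h52 B' hb' hB' hsmall' hc₃' hb'1 hj A r hr hrc hA z κ')
    (fun j hj A r hr hA z κ' => level_lin L hL hG k U₀ hU₀ hα hα3 hα8 h52 B' hb' hB' hsmall' hc₃' hb'1 hj A r hr hA z κ')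
    B hb hB (logCovIter L (expCfg B' * U₀) B) (linCovIter L (expCfg B' * U₀) B) rfl
    (fun j _ => funext fun z => funext fun κ' => logCovIter_succ_mul_background L U₀ (expCfg B') B j z κ') rfl
    (fun j _ => funext fun z => funext fun κ' => linCovIter_succ_mul_background L U₀ (expCfg B') B j z κ')
    hP hsmall (levels_le_c3 hL1 hb hc₃)
  intro j hj
  obtain ⟨hEj, -, hT⟩ := hmain j hj
  refine ⟨fun z κ' => (hEj z κ').trans ?_, hT⟩
  have hPj := (prod_range_mono _ hκ0 hj).trans hP
  have h8 : 0 ≤ 8 * (2097152 * ((d : ℝ) + 1) ^ 2) := by positivity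
  exact mul_le_mul_of_nonneg_right (mul_le_mul_of_nonneg_left hPj h8) (sq_nonneg _)

end Levels

/-! ## §3 «Q_k(U′U₀, ηA) is analytic in complex variables A′, A» -/

section Analytic

variable (L : ℕ) (hL : 2 ≤ L) {G : Subgroup 𝔸ˣ} (hG : AvgClosed d L G) (k : ℕ)
  (U₀ : Site d → Fin d → 𝔸ˣ) (hU₀ : ∀ x κ, U₀ x κ ∈ G) {α₀ : ℝ} (hα : 0 < α₀)
  (hα3 : C0 d * α₀ ≤ 1 / 3) (hα8 : 8 * α₀ ≤ c2' d L) (h52 : pdev U₀ < α₀ * (((L : ℝ) ^ k)⁻¹) ^ 2)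
  (B' : E → Site d → Fin d → 𝔸) {t₀ : E} (hB'a : ∀ x κ, AnalyticAt ℂ (fun t => B' t x κ) t₀)
  {b' : ℝ} (hb' : 0 ≤ b') (hB' : ∀ x κ, ‖B' t₀ x κ‖ ≤ b')
  (hsmall' : Real.exp (4 * (800 * ((d : ℝ) + 1) ^ 2 * ((d : ℝ) + 4)) * α₀)
    * (1 + 8 * (131072 * ((d : ℝ) + 1) ^ 2) * ((L : ℝ) ^ k * b')) ≤ 2)
  (hc₃' : 2 * ((L : ℝ) ^ k * b') ≤ c3 d L) (hb'1 : 409600 * ((d : ℝ) + 1) ^ 2 * ((L : ℝ) ^ k * b') ≤ 1)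

include hL hG hU₀ hα hα3 hα8 h52 hB'a hb' hB' hsmall' hc₃' hb'1 in
/-- **THE LEVEL BACKGROUNDS `\overline{U′U₀}ʲ(t)` ARE BONDWISE-ANALYTIC UNIT FAMILIES** (values and inverses), for every `j ≤ k`, when
`U′ = e^{B′(t)}` with `B′` bondwise analytic at `t₀` and the data of §2 at `t₀` — Prop. 6's analyticity clause re-derived level by level from the
one-step average (42) (`B7Prop7OneStepAnalytic.analyticAt_bavg_family`), the block loops of `Ũ′ʲ(t₀)·Ū₀ʲ` lying in the domain of the series
logarithm (`level_loops_lt_one`). [cite: Balaban1985Averaging, Proposition 7 p.43, Proposition 6 p.43, (43) p.24] -/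
theorem analyticAt_avgIter_cplx :
    ∀ j ≤ k, ∀ (x : Site d) (μ : Fin d),
      AnalyticAt ℂ (fun t => ((avgIter L (expCfg (B' t) * U₀) j x μ : 𝔸ˣ) : 𝔸)) t₀ ∧
        AnalyticAt ℂ (fun t => (((avgIter L (expCfg (B' t) * U₀) j x μ)⁻¹ : 𝔸ˣ) : 𝔸)) t₀ := by
  intro j
  induction j with
  | zero =>
    intro _ x μ
    simp only [avgIter_zero]
    exact analyticAt_bond_mul_family (analyticAt_bond_expCfg_family B' hB'a) (analyticAt_bond_const_family U₀ t₀) x μ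
  | succ j ih =>
    intro hjk x μ
    have hj : j < k := Nat.lt_of_succ_le hjk
    have hZ := ih hj.le
    have hW := level_loops_lt_one L hL hG k U₀ hU₀ hα hα3 hα8 h52 (B' t₀) hb' hB' hsmall' hc₃' hb'1 hj ((L : ℤ) • x) μ
    have hcfg : tildIter L U₀ (expCfg (B' t₀)) j * avgIter L U₀ j = avgIter L (expCfg (B' t₀) * U₀) j :=
      tildIter_mul L U₀ (expCfg (B' t₀)) j
    simp only [hcfg] at hW
    have h := analyticAt_bavg_family (Z := fun t => avgIter L (expCfg (B' t) * U₀) j) hZ L ((L : ℤ) • x) μ hW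
    simp only [avgIter_succ, rescale_apply]
    exact h

include hL hG hU₀ hα hα3 hα8 h52 hB'a hb' hB' hsmall' hc₃' hb'1 in
/-- **PROPOSITION 7, THE ANALYTICITY — «the function Q_k(U′U₀, ηA) is analytic in complex variables A′, A»**: for bondwise-analytic families
`B′(t)` (background perturbation, `U′ = e^{B′(t)}`) and `B(t)` (field), `t` in any complex normed space `E` — e.g. `t = (a′, a) ∈ 𝔸^S × 𝔸^S` with
the insertion of finitely many bond variables — satisfying the DATA of the module docstring at `t₀`, every composite
`t ↦ Q_j(e^{B′(t)}U₀, B(t))(c) = logCovIter L (e^{B′(t)}U₀) (B(t)) j c`, `j ≤ k`, is analytic at `t₀`.  Induction on `j` (print's «composition of the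
functions (127)» at the complex level backgrounds): the `(j+1)`-st factor is the one-step map at `Ũ′ʲ(t)·Ū₀ʲ` (`B7Prop7OneStep.logCovIter_succ_mul_background`),
jointly analytic by `B7Prop7OneStepAnalytic.prop7_oneStep_analyticAt` on the domain supplied by (131) for `Q_j(U′U₀, ·)` (§2), by (164) for `Ũ′ʲ` and by
Props. 1–2 for `Ū₀ʲ` (§1); `Ũ′ʲ(t)` is an analytic unit family by `analyticAt_avgIter_cplx`. [cite: Balaban1985Averaging, Proposition 7 p.43] -/
theorem prop7_analyticAt (B : E → Site d → Fin d → 𝔸) (hBa : ∀ x κ, AnalyticAt ℂ (fun t => B t x κ) t₀)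
    {b : ℝ} (hb : 0 ≤ b) (hB : ∀ x κ, ‖B t₀ x κ‖ ≤ b)
    (hsmall : Real.exp (4480 * ((d : ℝ) + 1) ^ 2 * ((d : ℝ) + 4) * α₀ + 240000 * ((d : ℝ) + 1) ^ 3 * ((L : ℝ) ^ k * b'))
      * (1 + 8 * (2097152 * ((d : ℝ) + 1) ^ 2) * ((L : ℝ) ^ k * b)) ≤ 2)
    (hc₃ : 2 * ((L : ℝ) ^ k * b) ≤ c3 d L / 4) :
    ∀ j ≤ k, ∀ (z : Site d) (κ : Fin d),
      AnalyticAt ℂ (fun t => logCovIter L (expCfg (B' t) * U₀) (B t) j z κ) t₀ := by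
  have hL1 : 1 ≤ L := le_trans (by norm_num) hL
  have hL1r : (1 : ℝ) ≤ L := by exact_mod_cast hL1
  have hα4 : 4 * α₀ ≤ c2' d L := by linarith
  have hbg := level_background_data L hL hG k U₀ hU₀ hα hα3 hα8 h52
  have hpert := level_pert_data L hL hG k U₀ hU₀ hα hα3 hα4 h52 (B' t₀) hb' hB' hsmall' hc₃' hb'1
  have h131 := fun j hj => (prop7_prop4_uniform L hL hG k U₀ hU₀ hα hα3 hα8 h52 (B' t₀) hb' hB' hsmall' hc₃' hb'1
    (B t₀) hb hB hsmall hc₃ j hj).2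
  have hZ := analyticAt_avgIter_cplx L hL hG k U₀ hU₀ hα hα3 hα8 h52 B' hB'a hb' hB' hsmall' hc₃' hb'1
  have hncast : (((2 * (d * L) + L + L : ℕ)) : ℝ) = 2 * ((d : ℝ) + 1) * L := by push_cast; ring
  have hnc3 : (((2 * (d * L) + L + L : ℕ)) : ℝ) * (c3 d L / 4) = 1 / 256 := by
    rw [hncast, c3]
    have hL0 : (0 : ℝ) < L := by linarith
    field_simp
    ring
  intro j
  induction j with
  | zero => intro _ z κ; simpa only [logCovIter_zero] using hBa z κ
  | succ j ih =>
    intro hjk z κ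
    have hj : j < k := Nat.lt_of_succ_le hjk
    obtain ⟨hV, hloops⟩ := hbg j hj.le
    obtain ⟨hreg, hα1⟩ := hloops ((L : ℤ) • z) κ
    have hU := hpert j hj.le
    have hnu := level_nu_le L hL k hb' hb'1 hj
    -- the field at level `j` has sup norm `≤ 2Lʲb ≤ c₃/4` ((131) for `Q_j(U′U₀, ·)`)
    have ha : 0 ≤ 2 * ((L : ℝ) ^ j * b) := by positivity
    have hA := h131 j hj.le
    have hac : 2 * ((L : ℝ) ^ j * b) ≤ c3 d L / 4 := by
      have := mul_le_mul_of_nonneg_right (pow_le_pow_right₀ hL1r hj.le) hb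
      linarith
    have hθ : (((2 * (d * L) + L + L : ℕ)) : ℝ) * (2 * ((L : ℝ) ^ j * b) + 2 * (400 * ((d : ℝ) + 1) * ((L : ℝ) ^ j * b')))
        ≤ 1 / 128 := by
      have h1 : (((2 * (d * L) + L + L : ℕ)) : ℝ) * (2 * ((L : ℝ) ^ j * b)) ≤ 1 / 256 := by
        rw [← hnc3]; exact mul_le_mul_of_nonneg_left hac (by positivity)
      nlinarith
    -- the perturbation family `Ũ′ʲ(t)` is a bondwise-analytic unit family
    have hUa : ∀ y ν, AnalyticAt ℂ (fun t => ((tildIter L U₀ (expCfg (B' t)) j y ν : 𝔸ˣ) : 𝔸)) t₀ ∧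
        AnalyticAt ℂ (fun t => (((tildIter L U₀ (expCfg (B' t)) j y ν)⁻¹ : 𝔸ˣ) : 𝔸)) t₀ := by
      intro y ν
      obtain ⟨h1, h2⟩ := hZ j hj.le y ν
      refine ⟨?_, ?_⟩
      · simp only [tildIter_apply, Units.val_mul]
        exact h1.fun_mul analyticAt_const
      · simp only [tildIter_apply, mul_inv_rev, inv_inv, Units.val_mul]
        exact analyticAt_const.fun_mul h2
    have hstep := prop7_oneStep_analyticAt (E := E) hL1 hV (U'' := fun t => tildIter L U₀ (expCfg (B' t)) j) hUa
      (by positivity) hU (fun t => logCovIter L (expCfg (B' t) * U₀) (B t) j) (fun y ν => ih hj.le y ν) ha hA hθ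
      (by norm_num) le_rfl ((L : ℤ) • z) κ hα1 hreg
    have hfun : (fun t => logCovIter L (expCfg (B' t) * U₀) (B t) (j + 1) z κ)
        = fun t => Qcov L (tildIter L U₀ (expCfg (B' t)) j * avgIter L U₀ j) (logCovIter L (expCfg (B' t) * U₀) (B t) j)
            ((L : ℤ) • z) κ := funext fun t => logCovIter_succ_mul_background L U₀ (expCfg (B' t)) (B t) j z κ
    rw [hfun]
    exact hstep

end Analytic

end Literature.MathematicalPhysics.QuantumFieldTheory.Balaban1983to89.B7Prop7Levels

end
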